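import Mathlib
import Summits.Ventures.HodgeRepro.Tier4.Target
import Summits.Ventures.HodgeRepro.Tier4.Line3.Defs
import Summits.Ventures.HodgeRepro.Tier4.Line3.DefsLemmas
import Summits.Ventures.HodgeRepro.Tier4.Line3.ShrinkMajGauss
import Summits.Ventures.HodgeRepro.Tier4.Line3.IntegralScalarExcess
import Summits.Ventures.HodgeRepro.Tier4.Line3.QuarticProfile
import Summits.Ventures.HodgeRepro.Tier4.Line3.QuarticShapeOfCard
import Summits.Ventures.HodgeRepro.Tier4.Line3.QuarticUnitGap

/-!
# Tier4/Line3/QuarticNormOne — norm-one elements of a quartic CM field with τ₀-modulus just above 1: every field clause of the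
quartic window display is a theorem

Blind re-derivation cell `pub-hodge-repro`, Tier 4 «PROVE THE STEP», LINE L3, seat t4-L3-p2 (g3): the cut C-L3-NORMONE
(STATUS S14603), after t4-crit-1 g7's record S14591 that the quartic window display (skeleton v0.55 II-ae) types its scaling
element `w : E` with NO integrality — reading (b): any non-zero `w` with `‖τ₀ w‖² = η₀` and `‖σ w‖² = 1/η₀` at the definite
embeddings serves `Line3.WindowCentre`, and `UnitGap` is monotone in `η₀`.

* `unitGap_of_le`: `UnitGap η → 1 < η₀ → η₀ ≤ η → UnitGap η₀`.
* Since `E/ℚ` is Galois, a definite embedding `σ₁` factors through a ring endomorphism `g` of `E`: `σ₁ = τ₀ ∘ g`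
  (`exists_ringHom_of_emb`, Mathlib's `AlgHom.restrictNormal` along `τ₀`); `σ₁ ∘ g ∈ {τ₀, τ̄₀}` because `g ≠ id`, `g ≠ c`
  (`norm_emb_comp_eq`: `‖σ₁ (g a)‖ = ‖τ₀ a‖`, no group theory of `Gal(E/ℚ)`).
* For `a ≠ 0` the element `w = a / g a` has `‖τ₀ w‖² = ‖τ₀ a‖²/‖σ₁ a‖²`, `‖σ w‖² = 1/‖τ₀ w‖²` at every definite `σ`, and
  `|N w| = 1` (`normOne_quot`).
* With `a_n = n + b` for a `b` with `τ₀ b ∉ {σ₁ b, conj (σ₁ b)}` (`exists_b_ne`: `E` is not the union of two proper subgroups),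
  the ratios `R_n = ‖n + τ₀ b‖²/‖n + σ₁ b‖²` tend to `1` (`tendsto_ratio`) and are `≠ 1` for all but one `n`
  (`ratio_ne_one_of_consecutive`), so some `n` has `R_n ∈ (1/B, B) ∖ {1}` — `exists_normOne_of_lt`: for every `B > 1` a
  norm-one `w` with `1 < ‖τ₀ w‖² < B`.
* `exists_quartic_field_clauses`: on a quartic CM field there are `η₀` and `w` with `1 < η₀`, `UnitGap η₀`,
  `η₀² − 6η₀ + 1 ≤ 0`, `w ≠ 0`, `‖τ₀ w‖² = η₀`, `‖σ w‖² = 1/η₀` (`σ ∈ defEmb`) — the whole `∃ η₀ w` block of the display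
  minus the centre's non-boundary clause, for EVERY quartic datum (`B := min η_ε 5` with `η_ε` the unit gap of
  `Line3.QuarticUnitGap`).

Nothing here says anything about the status of the Hodge conjecture for CM abelian varieties, which is NOT proved
(HC_CM is NOT proved by anyone in this repository).
-/

set_option autoImplicit false

noncomputable section

namespace Summit.Ventures.HodgeRepro.Tier4.Line3

open Summit.Ventures.HodgeRepro.Tier4
open NumberField Filter Topology
open scoped ComplexConjugate
open scoped Classical

/-! ## A. Real analysis: the ratios `‖n + z₁‖² / ‖n + z₂‖²` -/

/-- `‖n + z‖² / n² → 1`. -/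
theorem tendsto_normSq_add_div (z : ℂ) :
    Tendsto (fun n : ℕ => ‖(n : ℂ) + z‖ ^ 2 / (n : ℝ) ^ 2) atTop (𝓝 1) := by
  have hinv : Tendsto (fun n : ℕ => ((n : ℂ))⁻¹) atTop (𝓝 0) := by
    have h := (Complex.continuous_ofReal.tendsto 0).comp
      (tendsto_inv_atTop_zero.comp (tendsto_natCast_atTop_atTop (R := ℝ)))
    simpa [Function.comp_def] using h
  have h0 : Tendsto (fun n : ℕ => z / (n : ℂ)) atTop (𝓝 0) := by
    simpa [div_eq_mul_inv] using hinv.const_mul z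
  have h1' : Tendsto (fun n : ℕ => (1 : ℂ) + z / (n : ℂ)) atTop (𝓝 1) := by
    simpa using (tendsto_const_nhds (x := (1 : ℂ))).add h0
  have h1 : Tendsto (fun n : ℕ => ‖(1 : ℂ) + z / (n : ℂ)‖ ^ 2) atTop (𝓝 1) := by
    have := ((continuous_norm.tendsto (1 : ℂ)).comp h1').pow 2
    simpa [Function.comp_def] using this
  refine h1.congr' ?_
  filter_upwards [eventually_ge_atTop 1] with n hn
  have hn0 : (n : ℂ) ≠ 0 := by exact_mod_cast (by omega : n ≠ 0)
  rw [show (1 : ℂ) + z / (n : ℂ) = ((n : ℂ) + z) / (n : ℂ) by field_simp, norm_div, div_pow,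
    Complex.norm_natCast]

/-- `‖n + z₁‖² / ‖n + z₂‖² → 1`. -/
theorem tendsto_ratio (z₁ z₂ : ℂ) :
    Tendsto (fun n : ℕ => ‖(n : ℂ) + z₁‖ ^ 2 / ‖(n : ℂ) + z₂‖ ^ 2) atTop (𝓝 1) := by
  have h := (tendsto_normSq_add_div z₁).div (tendsto_normSq_add_div z₂) one_ne_zero
  rw [div_one] at h
  refine h.congr' ?_
  filter_upwards [eventually_ge_atTop 1] with n hn
  have hn0 : (n : ℝ) ^ 2 ≠ 0 := by
    have : (n : ℝ) ≠ 0 := by exact_mod_cast (by omega : n ≠ 0)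
    exact pow_ne_zero 2 this
  exact div_div_div_cancel_right₀ hn0 _ _

/-- `‖n + z‖² = n² + 2 n Re z + ‖z‖²`. -/
theorem norm_natCast_add_sq (n : ℕ) (z : ℂ) :
    ‖(n : ℂ) + z‖ ^ 2 = (n : ℝ) ^ 2 + 2 * n * z.re + ‖z‖ ^ 2 := by
  rw [Complex.sq_norm, Complex.sq_norm, Complex.normSq_add, Complex.normSq_natCast]
  simp only [Complex.mul_re, Complex.natCast_re, Complex.natCast_im, Complex.conj_re, Complex.conj_im]
  ring

/-- Two consecutive ratios cannot both be `1` unless `z₁ ∈ {z₂, conj z₂}`. -/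
theorem ratio_ne_one_of_consecutive {z₁ z₂ : ℂ} (h1 : z₁ ≠ z₂) (h2 : z₁ ≠ conj z₂) (n : ℕ)
    (hn : ‖(n : ℂ) + z₂‖ ≠ 0) (hn' : ‖((n + 1 : ℕ) : ℂ) + z₂‖ ≠ 0) :
    ‖(n : ℂ) + z₁‖ ^ 2 / ‖(n : ℂ) + z₂‖ ^ 2 ≠ 1 ∨
      ‖((n + 1 : ℕ) : ℂ) + z₁‖ ^ 2 / ‖((n + 1 : ℕ) : ℂ) + z₂‖ ^ 2 ≠ 1 := by
  by_contra hcon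
  push Not at hcon
  obtain ⟨e1, e2⟩ := hcon
  rw [div_eq_one_iff_eq (pow_ne_zero 2 hn), norm_natCast_add_sq, norm_natCast_add_sq] at e1
  rw [div_eq_one_iff_eq (pow_ne_zero 2 hn'), norm_natCast_add_sq, norm_natCast_add_sq] at e2
  push_cast at e2
  have hre : z₁.re = z₂.re := by nlinarith
  have hsq : ‖z₁‖ ^ 2 = ‖z₂‖ ^ 2 := by nlinarith
  rw [Complex.sq_norm, Complex.sq_norm, Complex.normSq_apply, Complex.normSq_apply, hre] at hsq
  have him : z₁.im ^ 2 = z₂.im ^ 2 := by nlinarith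
  rcases sq_eq_sq_iff_eq_or_eq_neg.1 him with h | h
  · exact h1 (Complex.ext hre h)
  · exact h2 (Complex.ext (by rw [Complex.conj_re]; exact hre) (by rw [Complex.conj_im]; exact h))

/-- The lower bound `‖n + z‖ ≥ n − ‖z‖`. -/
theorem norm_natCast_add_pos {z : ℂ} {n : ℕ} (hn : ‖z‖ < n) : 0 < ‖(n : ℂ) + z‖ := by
  have h := norm_add_le ((n : ℂ) + z) (-z)
  rw [add_neg_cancel_right, norm_neg, Complex.norm_natCast] at h
  linarith

namespace T4Data

variable (X : T4Data)

/-! ## B. The unit gap is monotone -/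

/-- `UnitGap` is monotone: a smaller gap constant is a weaker statement. -/
theorem unitGap_of_le {η η₀ : ℝ} (h : X.UnitGap η) (hη₀ : 1 < η₀) (hle : η₀ ≤ η) : X.UnitGap η₀ := by
  intro x hx hx0 hN hc
  rcases h x hx hx0 hN hc with h1 | h1
  · left
    linarith
  · right
    have hη : 0 < η := by linarith
    have hη₀' : 0 < η₀ := by linarith
    calc ‖X.τ₀ x‖ ^ 2 ≤ 1 / η := h1
      _ ≤ 1 / η₀ := one_div_le_one_div_of_le hη₀' hle

/-! ## C. A definite embedding factors through an endomorphism of `E` (Galois) -/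

/-- **`E/ℚ` IS GALOIS**: every complex embedding `σ₁` is `τ₀ ∘ g` for a ring endomorphism `g` of `E`
(`AlgHom.restrictNormal` of `σ₁` along `τ₀`). -/
theorem exists_ringHom_of_emb (σ₁ : X.E →+* ℂ) : ∃ g : X.E →+* X.E, ∀ x, X.τ₀ (g x) = σ₁ x := by
  letI : Algebra X.E ℂ := X.τ₀.toAlgebra
  haveI : IsScalarTower ℚ X.E ℂ := IsScalarTower.of_algebraMap_eq (fun q => by
    rw [RingHom.algebraMap_toAlgebra, eq_ratCast (algebraMap ℚ X.E) q, map_ratCast, eq_ratCast])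
  refine ⟨((σ₁.toRatAlgHom).restrictNormal X.E).toRingHom, fun x => ?_⟩
  have h := AlgHom.restrictNormal_commutes (σ₁.toRatAlgHom) X.E x
  simpa [RingHom.algebraMap_toAlgebra] using h

/-- A definite embedding is neither `τ₀` nor its conjugate. -/
theorem ne_tau_of_mem_defEmb {σ : X.E →+* ℂ} (hσ : σ ∈ X.defEmb) : σ ≠ X.τ₀ ∧ σ ≠ conjEmb X.τ₀ := by
  simpa only [defEmb, Finset.mem_filter, Finset.mem_univ, true_and] using hσ

/-- **`σ₁ ∘ g ∈ {τ₀, τ̄₀}`** in the quartic shape: `σ₁ ∘ g = σ₁` would force `g = id` (then `σ₁ = τ₀`), `σ₁ ∘ g = σ̄₁` would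
force `g = c` (then `σ₁ = τ̄₀`); so `‖σ₁ (g a)‖ = ‖τ₀ a‖`. -/
theorem norm_emb_comp_eq {σ₁ : X.E →+* ℂ} (hdef : X.defEmb = {σ₁, conjEmb σ₁})
    {g : X.E →+* X.E} (hg : ∀ x, X.τ₀ (g x) = σ₁ x) (a : X.E) : ‖σ₁ (g a)‖ = ‖X.τ₀ a‖ := by
  have hσ₁ : σ₁ ∈ X.defEmb := by rw [hdef]; exact Finset.mem_insert_self _ _
  have hσ' := X.ne_tau_of_mem_defEmb hσ₁
  rcases X.emb_eq_tau_or_conj_or_def (σ₁.comp g) with h | h | h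
  · have := congrArg (fun φ : X.E →+* ℂ => φ a) h
    simp only [RingHom.comp_apply] at this
    rw [this]
  · have := congrArg (fun φ : X.E →+* ℂ => φ a) h
    simp only [RingHom.comp_apply] at this
    rw [this, X.norm_conjEmb_apply]
  · exfalso
    rw [hdef, Finset.mem_insert, Finset.mem_singleton] at h
    rcases h with h | h
    · -- `g = id`, so `σ₁ = τ₀`
      have hid : ∀ x, g x = x := fun x => σ₁.injective (by
        have := congrArg (fun φ : X.E →+* ℂ => φ x) h
        simpa using this)
      exact hσ'.1 (RingHom.ext fun x => by rw [← hg x, hid x])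
    · -- `g = c`, so `σ₁ = τ̄₀`
      have hc : ∀ x, g x = X.c x := fun x => σ₁.injective (by
        have := congrArg (fun φ : X.E →+* ℂ => φ x) h
        simp only [RingHom.comp_apply] at this
        rw [this, X.conj_emb_c]
        rfl)
      exact hσ'.2 (RingHom.ext fun x => by
        rw [← hg x, hc x, X.conj_emb_c]
        rfl)

/-- There is `b` with `τ₀ b ∉ {σ₁ b, conj (σ₁ b)}`: `E` is not the union of the two proper subgroups where they agree. -/
theorem exists_b_ne {σ₁ : X.E →+* ℂ} (hσ₁ : σ₁ ∈ X.defEmb) :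
    ∃ b : X.E, X.τ₀ b ≠ σ₁ b ∧ X.τ₀ b ≠ conj (σ₁ b) := by
  have hσ' := X.ne_tau_of_mem_defEmb hσ₁
  obtain ⟨b₁, hb₁⟩ : ∃ b, X.τ₀ b ≠ σ₁ b := by
    by_contra h
    push Not at h
    exact hσ'.1 (RingHom.ext fun x => (h x).symm)
  obtain ⟨b₂, hb₂⟩ : ∃ b, X.τ₀ b ≠ conj (σ₁ b) := by
    by_contra h
    push Not at h
    exact hσ'.2 (RingHom.ext fun x => by
      show σ₁ x = conj (X.τ₀ x)
      rw [h x, Complex.conj_conj])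
  by_cases hb₁' : X.τ₀ b₁ ≠ conj (σ₁ b₁)
  · exact ⟨b₁, hb₁, hb₁'⟩
  push Not at hb₁'
  by_cases hb₂' : X.τ₀ b₂ ≠ σ₁ b₂
  · exact ⟨b₂, hb₂', hb₂⟩
  push Not at hb₂'
  refine ⟨b₁ + b₂, ?_, ?_⟩
  · rw [map_add, map_add, hb₁', hb₂']
    intro h
    have : conj (σ₁ b₁) = σ₁ b₁ := add_right_cancel h
    exact hb₁ (hb₁'.trans this)
  · rw [map_add, map_add, map_add, hb₁', hb₂']
    intro h
    have : σ₁ b₂ = conj (σ₁ b₂) := add_left_cancel h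
    exact hb₂ (hb₂'.trans this)

/-! ## D. The norm-one element `a / g a` -/

/-- **THE QUOTIENT `a / g a`**: `τ₀`-modulus `‖τ₀ a‖²/‖σ₁ a‖²`, the reciprocal at every definite embedding, absolute norm `1`. -/
theorem normOne_quot {σ₁ : X.E →+* ℂ} (hσ : σ₁ ≠ conjEmb σ₁) (hdef : X.defEmb = {σ₁, conjEmb σ₁})
    {g : X.E →+* X.E} (hg : ∀ x, X.τ₀ (g x) = σ₁ x) {a : X.E} (ha : a ≠ 0) :
    a / g a ≠ 0 ∧ ‖X.τ₀ (a / g a)‖ ^ 2 = ‖X.τ₀ a‖ ^ 2 / ‖σ₁ a‖ ^ 2 ∧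
      (∀ σ ∈ X.defEmb, ‖σ (a / g a)‖ ^ 2 = 1 / (‖X.τ₀ a‖ ^ 2 / ‖σ₁ a‖ ^ 2)) ∧
      |Algebra.norm ℚ (a / g a)| = 1 := by
  have hga : g a ≠ 0 := (map_ne_zero g).2 ha
  have hw : a / g a ≠ 0 := div_ne_zero ha hga
  have hτ : ‖X.τ₀ (a / g a)‖ ^ 2 = ‖X.τ₀ a‖ ^ 2 / ‖σ₁ a‖ ^ 2 := by
    rw [map_div₀, norm_div, hg, div_pow]
  have hσ₁' : ‖σ₁ (a / g a)‖ ^ 2 = 1 / (‖X.τ₀ a‖ ^ 2 / ‖σ₁ a‖ ^ 2) := by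
    rw [map_div₀, norm_div, X.norm_emb_comp_eq hdef hg, div_pow, one_div_div]
  have hdefs : ∀ σ ∈ X.defEmb, ‖σ (a / g a)‖ ^ 2 = 1 / (‖X.τ₀ a‖ ^ 2 / ‖σ₁ a‖ ^ 2) := by
    intro σ hσ'
    rw [hdef, Finset.mem_insert, Finset.mem_singleton] at hσ'
    rcases hσ' with rfl | rfl
    · exact hσ₁'
    · rw [X.norm_conjEmb_apply]
      exact hσ₁'
  refine ⟨hw, hτ, hdefs, ?_⟩
  have hN := X.abs_norm_eq_quartic hσ hdef (a / g a)
  have hτ0 : ‖X.τ₀ a‖ ^ 2 / ‖σ₁ a‖ ^ 2 ≠ 0 := by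
    have h1 : ‖X.τ₀ a‖ ≠ 0 := norm_ne_zero_iff.2 ((map_ne_zero X.τ₀).2 ha)
    have h2 : ‖σ₁ a‖ ≠ 0 := norm_ne_zero_iff.2 ((map_ne_zero σ₁).2 ha)
    positivity
  rw [hτ, hσ₁', mul_one_div_cancel hτ0] at hN
  exact_mod_cast hN

/-! ## E. A norm-one element with `τ₀`-modulus in `(1, B)` -/

/-- **NORM-ONE ELEMENTS WITH `τ₀`-MODULUS JUST ABOVE `1`**: on a quartic CM field, for every `B > 1` there is a non-zero `w` of
absolute norm `1` with `1 < ‖τ₀ w‖² < B` and `‖σ w‖² = 1/‖τ₀ w‖²` at every definite embedding — `w = (a_n / g a_n)^{±1}`,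
`a_n = n + b`, `n` large. -/
theorem exists_normOne_of_lt (h4 : Fintype.card (X.E →+* ℂ) = 4) {B : ℝ} (hB : 1 < B) :
    ∃ (η₀ : ℝ) (w : X.E), 1 < η₀ ∧ η₀ < B ∧ w ≠ 0 ∧ |Algebra.norm ℚ w| = 1 ∧ ‖X.τ₀ w‖ ^ 2 = η₀ ∧
      ∀ σ ∈ X.defEmb, ‖σ w‖ ^ 2 = 1 / η₀ := by
  obtain ⟨σ₁, hσ, hdef⟩ := X.quarticShape_of_card h4
  have hσ₁ : σ₁ ∈ X.defEmb := by rw [hdef]; exact Finset.mem_insert_self _ _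
  obtain ⟨g, hg⟩ := X.exists_ringHom_of_emb σ₁
  obtain ⟨b, hb1, hb2⟩ := X.exists_b_ne hσ₁
  -- the ratios `R n = ‖n + τ₀ b‖² / ‖n + σ₁ b‖²` tend to `1`
  have hB0 : 0 < B := by linarith
  have hε : 0 < min (B - 1) (1 - 1 / B) := by
    refine lt_min (by linarith) ?_
    rw [sub_pos, div_lt_one hB0]
    exact hB
  obtain ⟨N, hN⟩ := (Metric.tendsto_atTop.1 (tendsto_ratio (X.τ₀ b) (σ₁ b))) _ hε
  -- an index `n ≥ N` beyond `‖σ₁ b‖` with `R n ≠ 1`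
  set N' : ℕ := max N (⌈‖σ₁ b‖⌉₊ + 1) with hN'
  have hN'N : N ≤ N' := le_max_left _ _
  have hN'b : ‖σ₁ b‖ < N' := by
    have h1 : ‖σ₁ b‖ ≤ ⌈‖σ₁ b‖⌉₊ := Nat.le_ceil _
    have h2 : (⌈‖σ₁ b‖⌉₊ + 1 : ℕ) ≤ N' := le_max_right _ _
    have h3 : ((⌈‖σ₁ b‖⌉₊ + 1 : ℕ) : ℝ) ≤ N' := by exact_mod_cast h2
    push_cast at h3
    linarith
  have hpos : ∀ n : ℕ, N' ≤ n → 0 < ‖(n : ℂ) + σ₁ b‖ := fun n hn =>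
    norm_natCast_add_pos (lt_of_lt_of_le hN'b (by exact_mod_cast hn))
  obtain ⟨n, hnN', hn1⟩ : ∃ n : ℕ, N' ≤ n ∧ ‖(n : ℂ) + X.τ₀ b‖ ^ 2 / ‖(n : ℂ) + σ₁ b‖ ^ 2 ≠ 1 := by
    rcases ratio_ne_one_of_consecutive hb1 hb2 N' (hpos N' le_rfl).ne'
      (hpos (N' + 1) (Nat.le_succ _)).ne' with h | h
    · exact ⟨N', le_rfl, h⟩
    · exact ⟨N' + 1, Nat.le_succ _, h⟩
  have hnN : N ≤ n := le_trans hN'N hnN'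
  have hdist := hN n hnN
  rw [Real.dist_eq] at hdist
  -- the element `a = n + b` and its quotient
  set a : X.E := (n : X.E) + b with ha
  have haτ : X.τ₀ a = (n : ℂ) + X.τ₀ b := by rw [ha, map_add, map_natCast]
  have haσ : σ₁ a = (n : ℂ) + σ₁ b := by rw [ha, map_add, map_natCast]
  have ha0 : a ≠ 0 := by
    intro h
    have := hpos n hnN'
    rw [← haσ, h, map_zero, norm_zero] at this
    exact lt_irrefl _ this
  obtain ⟨hw0, hτ, hdefs, hNw⟩ := X.normOne_quot hσ hdef hg ha0
  rw [haτ, haσ] at hτ hdefs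
  set R : ℝ := ‖(n : ℂ) + X.τ₀ b‖ ^ 2 / ‖(n : ℂ) + σ₁ b‖ ^ 2 with hR
  have hRpos : 0 < R := by
    have := hpos n hnN'
    have h2 : 0 < ‖(n : ℂ) + X.τ₀ b‖ ^ 2 := by
      have : (n : ℂ) + X.τ₀ b ≠ 0 := by rw [← haτ]; exact (map_ne_zero X.τ₀).2 ha0
      positivity
    positivity
  have hlt1 : R < 1 + min (B - 1) (1 - 1 / B) := by linarith [le_abs_self (R - 1)]
  have hgt1 : 1 - min (B - 1) (1 - 1 / B) < R := by linarith [neg_abs_le (R - 1)]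
  rcases lt_or_gt_of_ne hn1 with hR1 | hR1
  · -- `R < 1`: take `w = (a / g a)⁻¹`
    refine ⟨1 / R, (a / g a)⁻¹, ?_, ?_, inv_ne_zero hw0, ?_, ?_, ?_⟩
    · rw [lt_one_div one_pos hRpos, div_one]
      exact hR1
    · rw [one_div_lt hRpos hB0]
      have := min_le_right (B - 1) (1 - 1 / B)
      linarith
    · have h := congrArg abs (map_mul (Algebra.norm ℚ) (a / g a)⁻¹ (a / g a))
      rw [inv_mul_cancel₀ hw0, map_one, abs_one, abs_mul, hNw, mul_one] at h
      exact h.symm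
    · rw [map_inv₀, norm_inv, inv_pow, hτ, one_div]
    · intro σ hσ'
      rw [map_inv₀, norm_inv, inv_pow, hdefs σ hσ', one_div_one_div, one_div, inv_inv]
  · -- `1 < R`: take `w = a / g a`
    refine ⟨R, a / g a, hR1, ?_, hw0, hNw, hτ, hdefs⟩
    have := min_le_left (B - 1) (1 - 1 / B)
    linarith

/-! ## F. Every field clause of the quartic window display is a theorem -/

/-- **THE FIELD CLAUSES OF THE QUARTIC WINDOW DISPLAY ARE THEOREMS** on every quartic CM field: `η₀` and `w` with `1 < η₀`,
`UnitGap η₀`, `η₀² − 6η₀ + 1 ≤ 0`, `w ≠ 0`, `‖τ₀ w‖² = η₀`, `‖σ w‖² = 1/η₀` at every definite embedding (and `w` of absolute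
norm `1`) — `exists_normOne_of_lt` with `B = min η_ε 5`, `η_ε` the unit gap of `Line3.QuarticUnitGap`, and `unitGap_of_le`. -/
theorem exists_quartic_field_clauses (h4 : Fintype.card (X.E →+* ℂ) = 4) :
    ∃ (η₀ : ℝ) (w : X.E), 1 < η₀ ∧ X.UnitGap η₀ ∧ η₀ ^ 2 - 6 * η₀ + 1 ≤ 0 ∧ w ≠ 0 ∧ |Algebra.norm ℚ w| = 1 ∧
      ‖X.τ₀ w‖ ^ 2 = η₀ ∧ ∀ σ ∈ X.defEmb, ‖σ w‖ ^ 2 = 1 / η₀ := by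
  obtain ⟨η, hη, hgap, -, -⟩ := X.exists_unitGap_unit h4
  have hB : 1 < min η 5 := lt_min hη (by norm_num)
  obtain ⟨η₀, w, h1, hlt, hw0, hN, hτ, hdefs⟩ := X.exists_normOne_of_lt h4 hB
  refine ⟨η₀, w, h1, X.unitGap_of_le hgap h1 (le_trans hlt.le (min_le_left _ _)), ?_, hw0, hN, hτ, hdefs⟩
  have h5 : η₀ < 5 := lt_of_lt_of_le hlt (min_le_right _ _)
  nlinarith

end T4Data

end Summit.Ventures.HodgeRepro.Tier4.Line3

end
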